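import Summits.QuantumAdvantage.QuantumAdvantage.Theorems.NearExactIsExact.Negative.LinearStructure
import Summits.QuantumAdvantage.QuantumAdvantage.Theorems.CubicForrelationNearExactIsExactMmWalsh

/-!
# `NearExactIsExact` (stmt-QuantumAdvantage-14043), negative side — Walsh SUPPORT DENSITY bounds and the
# GENERAL (non-square) Maiorana–McFarland fibration

B2b disprover cell, generation 31 (`b2b-cforr-disprove-g31`).  HONEST FRAMING: kernel-checked STRUCTURE LEMMAS
(finite-sum identities and inequalities, [folklore]) — uniform in `n`, partner-free and degree-free necessary conditions
on near-exact pairs; they are NOT summit progress, produce no value above the records of the seat's `DISPROOF.md`, and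
neither prove nor refute the crux.

**1. Support density bounds the forrelation (any `n`, any Boolean `f, g`).**  If the unnormalised Walsh transform
`W_g(z) = Σ_y (-1)^{g(y)} (-1)^{y·z}` (`DerivativeWalsh.W`) vanishes outside a set `S = {z | P z}` then

  `Φ(f,g)² ≤ |S| / 2ⁿ`     (`ws_forrelation_sq_le_card`, and `ws_forrelation_sq_le_card_left` with the roles swapped).

Proof: `2ⁿ √(2ⁿ) Φ(f,g) = Σ_z (-1)^{f z} W_g(z) = Σ_z 1_S(z) (-1)^{f z} W_g(z)` (`hl_sum_signOf_mul_W`), Cauchy–Schwarz, and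
Parseval `Σ_z W_g(z)² = 4ⁿ`.  So a near-exact pair (`Φ > θ`) needs Walsh supports of density `> θ²` on BOTH sides; the
hyperplane-supported case `|S| = 2^{n-1}` (a linear structure, `Negative.LinearStructure`) is the instance `Φ² ≤ 1/2`.

**2. The general Maiorana–McFarland fibration.**  Let `g` be a Boolean function on `r + k` bits in the SIGN FORM

  `(-1)^{g(u ‖ y)} = (-1)^{u·λ(y)} (-1)^{h(y)}`,  `u ∈ 𝔽₂^r`, `y ∈ 𝔽₂^k`,

for an ARBITRARY map `λ : 𝔽₂^k → 𝔽₂^r` and an arbitrary `h : 𝔽₂^k → 𝔽₂` (no bijectivity, no `r = k`, no degree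
hypotheses; for `λ` coordinatewise quadratic and `h` cubic this is the general cubic "`M`-class fibration", square (`r = k`)
or not).  Then (Carlet, Relation (7.5))

  `W_g(a ‖ b) = 2^r Σ_{y : λ(y) = a} (-1)^{b·y} (-1)^{h(y)}`                     (`gf_W_append`),

so `W_g` vanishes on every block `a ∉ λ(𝔽₂^k)` (`gf_W_append_eq_zero`), and for EVERY Boolean partner `f`

  `Σ_{x,z} (-1)^{f x} (-1)^{x·z} (-1)^{g z} = 2^r Σ_y (-1)^{h(y)} W_{f(λ(y) ‖ ·)}(y)`        (`gf_fsum_eq`, the fibre identity: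
     the dual sum over the linear block pins the partner's slice `f(λ(y) ‖ ·)`; generalises `mw_fsum_signForm`, `r = k`),
  `Φ(f,g)² ≤ |λ(𝔽₂^k)| / 2^r`                                                  (`gf_forrelation_sq_le_card_image`),
  `Φ(f,g)² ≤ 2^k / 2^r`                                                         (`gf_forrelation_sq_le_two_pow`).

Consequences recorded for the seat (all partner-free): a near-exact fibration needs an image of density `> θ²` in `𝔽₂^r`
(for the square case: `π` "almost surjective"), and more linear than nonlinear variables (`r > k`) forces `Φ² ≤ 1/2` —
the non-square habitats worth searching have `r < k` (cf. `DISPROOF.md` §39).  The finer fibre-size form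
`Φ(f,g) ≤ Σ_a √(|λ⁻¹(a)| / 2^{r+k})` (`gf_forrelation_le_sum_sqrt_card_fibre`) is the forrelation analogue of the
Camion–Carlet–Charpin–Sendrier nonlinearity bound for `f_{φ,g}`.

References: S. Aaronson, A. Ambainis, Forrelation, SIAM J. Comput. 47 (2018) §1.1.1 (definition of `Φ`); R. O'Donnell,
Analysis of Boolean Functions (2014) §1.4 (Parseval); C. Carlet, Boolean Functions for Cryptography and Coding Theory, CUP
(2021) §6.1.15 and §7.1.9, Relation (7.5) (Walsh transform of `f_{φ,g}(x,y) = x·φ(y) ⊕ g(y)` fibre by fibre) and the bound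
(7.7) of Camion–Carlet–Charpin–Sendrier.  Everything below is proved; standard axioms only.
-/

set_option linter.dupNamespace false -- D-0017: single-problem summit ⇒ `QuantumAdvantage.QuantumAdvantage` by design

namespace Summit.QuantumAdvantage.QuantumAdvantage.Theorems.NearExactIsExact.Negative.WalshSupport

open Finset
open Literature.Computability.QuantumComplexity
open Literature.Computability.QuantumComplexity.BuzetChailloux (signOf_sq)
open Literature.Computability.QuantumComplexity.DerivativeWalsh (W)
open Literature.Computability.QuantumComplexity.MMReadout (forrelation_symm')
open Summit.QuantumAdvantage.QuantumAdvantage.Theorems.CubicForrelation.NearExactIsExact (mw_sum_linear_block)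
open Summit.QuantumAdvantage.QuantumAdvantage.Theorems.NearExactIsExact.Negative.HyperplaneLeak (hl_sum_signOf_mul_W)
open Summit.QuantumAdvantage.QuantumAdvantage.Theorems.NearExactIsExact.Negative.LinearStructure (ls_sum_W_sq)

variable {n : ℕ}

/-! ### 1. Walsh support density -/

/-- `Σ_z (-1)^{f z}·(-1)^{f z} = 2ⁿ` restricted to a predicate: `Σ_z (1_P(z) (-1)^{f z})² = |{z | P z}|`. [folklore] -/
theorem ws_sum_indicator_sq (f : (Fin n → Bool) → Bool) (P : (Fin n → Bool) → Prop) [DecidablePred P] :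
    ∑ z : Fin n → Bool, (if P z then signOf (f z) else 0) ^ 2 = ((univ.filter P).card : ℝ) := by
  rw [natCast_card_filter]
  refine sum_congr rfl fun z _ => ?_
  split_ifs
  · exact signOf_sq _
  · simp

/-- **Walsh support density bounds the forrelation.**  For ALL Boolean `f, g` on `n` bits and any predicate `P`:
if `W_g(z) = 0` whenever `¬ P z`, then `Φ(f,g)² ≤ |{z | P z}| / 2ⁿ`. [folklore] -/
theorem ws_forrelation_sq_le_card (f g : (Fin n → Bool) → Bool) (P : (Fin n → Bool) → Prop) [DecidablePred P]
    (hP : ∀ z, ¬ P z → W (fun y => signOf (g y)) z = 0) :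
    forrelation f g ^ 2 ≤ ((univ.filter P).card : ℝ) / (2 : ℝ) ^ n := by
  have hS := hl_sum_signOf_mul_W f g
  have h1 : ∑ z, signOf (f z) * W (fun y => signOf (g y)) z =
      ∑ z, (if P z then signOf (f z) else 0) * W (fun y => signOf (g y)) z := by
    refine sum_congr rfl fun z _ => ?_
    by_cases hz : P z
    · rw [if_pos hz]
    · rw [if_neg hz, hP z hz, mul_zero, zero_mul]
  have hCS := sum_mul_sq_le_sq_mul_sq (univ : Finset (Fin n → Bool))
    (fun z => if P z then signOf (f z) else 0) (fun z => W (fun y => signOf (g y)) z)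
  rw [← h1, hS, ws_sum_indicator_sq, ls_sum_W_sq] at hCS
  -- `hCS : (2ⁿ √(2ⁿ) Φ)² ≤ |S| · (2ⁿ · 2ⁿ)`
  have hK : Real.sqrt ((2 : ℝ) ^ n) ^ 2 = (2 : ℝ) ^ n := Real.sq_sqrt (by positivity)
  have hN : (0 : ℝ) < (2 : ℝ) ^ n := by positivity
  rw [le_div_iff₀ hN]
  have e : ((2 : ℝ) ^ n * Real.sqrt ((2 : ℝ) ^ n) * forrelation f g) ^ 2 =
      ((2 : ℝ) ^ n * (2 : ℝ) ^ n) * (forrelation f g ^ 2 * (2 : ℝ) ^ n) := by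
    rw [mul_pow, mul_pow, hK]; ring
  rw [e, mul_comm (((univ.filter P).card : ℝ))] at hCS
  exact le_of_mul_le_mul_left hCS (by positivity)

/-- The same bound with the support hypothesis on the LEFT function: if `W_f` vanishes outside `{z | P z}` then
`Φ(f,g)² ≤ |{z | P z}| / 2ⁿ` (`Φ` is symmetric). [folklore] -/
theorem ws_forrelation_sq_le_card_left (f g : (Fin n → Bool) → Bool) (P : (Fin n → Bool) → Prop) [DecidablePred P]
    (hP : ∀ z, ¬ P z → W (fun y => signOf (f y)) z = 0) :
    forrelation f g ^ 2 ≤ ((univ.filter P).card : ℝ) / (2 : ℝ) ^ n := by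
  rw [← forrelation_symm']
  exact ws_forrelation_sq_le_card g f P hP

/-- Threshold form: a Walsh support of density `≤ θ²` on either side excludes `Φ > θ` (for `θ ≥ 0`). [folklore] -/
theorem ws_forrelation_le_of_card_le (f g : (Fin n → Bool) → Bool) (P : (Fin n → Bool) → Prop) [DecidablePred P]
    (hP : ∀ z, ¬ P z → W (fun y => signOf (g y)) z = 0) {θ : ℝ} (hθ : 0 ≤ θ)
    (hcard : ((univ.filter P).card : ℝ) ≤ θ ^ 2 * (2 : ℝ) ^ n) : forrelation f g ≤ θ := by
  have h := ws_forrelation_sq_le_card f g P hP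
  have hN : (0 : ℝ) < (2 : ℝ) ^ n := by positivity
  have h2 : forrelation f g ^ 2 ≤ θ ^ 2 := h.trans ((div_le_iff₀ hN).2 hcard)
  exact abs_le_of_sq_le_sq' h2 hθ |>.2

/-! ### 2. The general Maiorana–McFarland fibration `(-1)^{g(u ‖ y)} = (-1)^{u·λ(y)} (-1)^{h(y)}` -/

section Fibration

variable {r k : ℕ}

/-- **Walsh transform of a general Maiorana–McFarland fibration, fibre by fibre** (Carlet, Relation (7.5)):
`W_g(a ‖ b) = 2^r Σ_{y : λ(y) = a} (-1)^{b·y} (-1)^{h(y)}`. [folklore] -/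
theorem gf_W_append (g : (Fin (r + k) → Bool) → Bool) (lam : (Fin k → Bool) → (Fin r → Bool))
    (h : (Fin k → Bool) → Bool)
    (hg : ∀ (u : Fin r → Bool) (y : Fin k → Bool), signOf (g (Fin.append u y)) = twist u (lam y) * signOf (h y))
    (a : Fin r → Bool) (b : Fin k → Bool) :
    W (fun z => signOf (g z)) (Fin.append a b) =
      (2 : ℝ) ^ r * ∑ y : Fin k → Bool, (if lam y = a then twist b y * signOf (h y) else 0) := by
  unfold W
  rw [sum_append, sum_comm, mul_sum]
  refine sum_congr rfl fun y _ => ?_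
  have e : ∀ u : Fin r → Bool, signOf (g (Fin.append u y)) * twist (Fin.append u y) (Fin.append a b) =
      twist b y * signOf (h y) * (twist a u * twist u (lam y)) := by
    intro u
    rw [hg, twist_append, twist_comm u a, twist_comm y b]
    ring
  rw [sum_congr rfl fun u _ => e u, ← mul_sum, mw_sum_linear_block]
  split_ifs <;> ring

/-- Off the image of `λ` the Walsh transform of the fibration vanishes: `a ∉ λ(𝔽₂^k) ⇒ W_g(a ‖ b) = 0`. [folklore] -/
theorem gf_W_append_eq_zero (g : (Fin (r + k) → Bool) → Bool) (lam : (Fin k → Bool) → (Fin r → Bool))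
    (h : (Fin k → Bool) → Bool)
    (hg : ∀ (u : Fin r → Bool) (y : Fin k → Bool), signOf (g (Fin.append u y)) = twist u (lam y) * signOf (h y))
    {a : Fin r → Bool} (ha : ∀ y, lam y ≠ a) (b : Fin k → Bool) :
    W (fun z => signOf (g z)) (Fin.append a b) = 0 := by
  rw [gf_W_append g lam h hg]
  simp [ha]

/-- **The fibre identity** for a general Maiorana–McFarland fibration and an ARBITRARY partner `f`:
`Σ_{x,z} (-1)^{f x} (-1)^{x·z} (-1)^{g z} = 2^r Σ_y (-1)^{h(y)} W_{f(λ(y) ‖ ·)}(y)` — the dual sum over the linear block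
pins the partner's slice over the fibre point. [folklore] -/
theorem gf_fsum_eq (f g : (Fin (r + k) → Bool) → Bool) (lam : (Fin k → Bool) → (Fin r → Bool))
    (h : (Fin k → Bool) → Bool)
    (hg : ∀ (u : Fin r → Bool) (y : Fin k → Bool), signOf (g (Fin.append u y)) = twist u (lam y) * signOf (h y)) :
    ∑ x : Fin (r + k) → Bool, ∑ z : Fin (r + k) → Bool, signOf (f x) * twist x z * signOf (g z) =
      (2 : ℝ) ^ r * ∑ y : Fin k → Bool, signOf (h y) *
        ∑ b : Fin k → Bool, signOf (f (Fin.append (lam y) b)) * twist b y := by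
  have e1 : ∑ x : Fin (r + k) → Bool, ∑ z, signOf (f x) * twist x z * signOf (g z) =
      ∑ x, signOf (f x) * W (fun z => signOf (g z)) x := by
    refine sum_congr rfl fun x _ => ?_
    unfold W
    rw [mul_sum]
    refine sum_congr rfl fun z _ => ?_
    rw [twist_comm z x]
    ring
  rw [e1, sum_append]
  -- per block `a`: `Σ_b (-1)^{f(a‖b)} W_g(a‖b) = Σ_y [λ y = a] 2^r (-1)^{h y} Σ_b (-1)^{f(λ y ‖ b)} (-1)^{b·y}`
  have e2 : ∀ a : Fin r → Bool,
      ∑ b : Fin k → Bool, signOf (f (Fin.append a b)) * W (fun z => signOf (g z)) (Fin.append a b) =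
        ∑ y : Fin k → Bool, (if lam y = a then (2 : ℝ) ^ r * (signOf (h y) *
          ∑ b : Fin k → Bool, signOf (f (Fin.append (lam y) b)) * twist b y) else 0) := by
    intro a
    have e3 : ∀ b : Fin k → Bool, signOf (f (Fin.append a b)) * W (fun z => signOf (g z)) (Fin.append a b) =
        ∑ y : Fin k → Bool, (if lam y = a then
          (2 : ℝ) ^ r * (signOf (h y) * (signOf (f (Fin.append (lam y) b)) * twist b y)) else 0) := by
      intro b
      rw [gf_W_append g lam h hg, mul_sum, mul_sum]
      refine sum_congr rfl fun y _ => ?_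
      split_ifs with hya
      · rw [hya]; ring
      · simp
    rw [sum_congr rfl fun b _ => e3 b, sum_comm]
    refine sum_congr rfl fun y _ => ?_
    by_cases hya : lam y = a
    · simp_rw [if_pos hya]
      rw [mul_sum, mul_sum]
    · simp_rw [if_neg hya]
      exact sum_const_zero
  rw [sum_congr rfl fun a _ => e2 a, sum_comm, mul_sum]
  refine sum_congr rfl fun y _ => ?_
  rw [sum_ite_eq]
  simp

/-- Parseval regrouped over the blocks: `Σ_a Σ_b W_g(a ‖ b)² = 2^{r+k} · 2^{r+k}`. [cite: ODonnell2014, §1.4] -/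
theorem gf_sum_sum_W_sq (g : (Fin (r + k) → Bool) → Bool) :
    ∑ a : Fin r → Bool, ∑ b : Fin k → Bool, W (fun z => signOf (g z)) (Fin.append a b) ^ 2 =
      (2 : ℝ) ^ (r + k) * (2 : ℝ) ^ (r + k) := by
  rw [← ls_sum_W_sq g]
  exact (sum_append (fun z => W (fun z => signOf (g z)) z ^ 2)).symm

/-- **Image density bounds the forrelation of a fibration.**  For EVERY Boolean `f` on `r + k` bits:
`Φ(f,g)² ≤ |λ(𝔽₂^k)| / 2^r`. [folklore] -/
theorem gf_forrelation_sq_le_card_image (f g : (Fin (r + k) → Bool) → Bool)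
    (lam : (Fin k → Bool) → (Fin r → Bool)) (h : (Fin k → Bool) → Bool)
    (hg : ∀ (u : Fin r → Bool) (y : Fin k → Bool), signOf (g (Fin.append u y)) = twist u (lam y) * signOf (h y)) :
    forrelation f g ^ 2 ≤ ((univ.image lam).card : ℝ) / (2 : ℝ) ^ r := by
  have hS := hl_sum_signOf_mul_W f g
  rw [sum_append] at hS
  -- insert the indicator of the image on the outer block
  have h1 : ∑ a : Fin r → Bool, ∑ b : Fin k → Bool,
        signOf (f (Fin.append a b)) * W (fun y => signOf (g y)) (Fin.append a b) =
      ∑ a : Fin r → Bool, (if a ∈ univ.image lam then (1 : ℝ) else 0) *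
        ∑ b : Fin k → Bool, signOf (f (Fin.append a b)) * W (fun y => signOf (g y)) (Fin.append a b) := by
    refine sum_congr rfl fun a _ => ?_
    by_cases ha : a ∈ univ.image lam
    · rw [if_pos ha, one_mul]
    · rw [if_neg ha, zero_mul]
      have ha' : ∀ y, lam y ≠ a := fun y hy => ha (mem_image.2 ⟨y, mem_univ _, hy⟩)
      exact sum_eq_zero fun b _ => by rw [gf_W_append_eq_zero g lam h hg ha' b, mul_zero]
  have hCS1 := sum_mul_sq_le_sq_mul_sq (univ : Finset (Fin r → Bool))
    (fun a => if a ∈ univ.image lam then (1 : ℝ) else 0)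
    (fun a => ∑ b : Fin k → Bool, signOf (f (Fin.append a b)) * W (fun y => signOf (g y)) (Fin.append a b))
  have hind : ∑ a : Fin r → Bool, (if a ∈ univ.image lam then (1 : ℝ) else 0) ^ 2 =
      ((univ.image lam).card : ℝ) := by
    have e : ∀ a : Fin r → Bool, (if a ∈ univ.image lam then (1 : ℝ) else 0) ^ 2 =
        if a ∈ univ.image lam then (1 : ℝ) else 0 := fun a => by split_ifs <;> norm_num
    simp_rw [e]
    rw [sum_ite_mem, univ_inter, sum_const, nsmul_eq_mul, mul_one]
  have hCS2 : ∀ a : Fin r → Bool,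
      (∑ b : Fin k → Bool, signOf (f (Fin.append a b)) * W (fun y => signOf (g y)) (Fin.append a b)) ^ 2 ≤
        (2 : ℝ) ^ k * ∑ b : Fin k → Bool, W (fun y => signOf (g y)) (Fin.append a b) ^ 2 := by
    intro a
    have hc := sum_mul_sq_le_sq_mul_sq (univ : Finset (Fin k → Bool))
      (fun b => signOf (f (Fin.append a b))) (fun b => W (fun y => signOf (g y)) (Fin.append a b))
    have e : ∑ b : Fin k → Bool, signOf (f (Fin.append a b)) ^ 2 = (2 : ℝ) ^ k := by
      simp_rw [signOf_sq]
      rw [sum_const, card_univ, Fintype.card_fun, Fintype.card_bool, Fintype.card_fin]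
      simp
    rwa [e] at hc
  have hmain : ((2 : ℝ) ^ (r + k) * Real.sqrt ((2 : ℝ) ^ (r + k)) * forrelation f g) ^ 2 ≤
      ((univ.image lam).card : ℝ) * ((2 : ℝ) ^ k * ((2 : ℝ) ^ (r + k) * (2 : ℝ) ^ (r + k))) := by
    rw [← hS, h1]
    refine hCS1.trans ?_
    rw [hind]
    refine mul_le_mul_of_nonneg_left ?_ (by positivity)
    calc ∑ a : Fin r → Bool,
          (∑ b : Fin k → Bool, signOf (f (Fin.append a b)) * W (fun y => signOf (g y)) (Fin.append a b)) ^ 2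
        ≤ ∑ a : Fin r → Bool, (2 : ℝ) ^ k * ∑ b : Fin k → Bool, W (fun y => signOf (g y)) (Fin.append a b) ^ 2 :=
          sum_le_sum fun a _ => hCS2 a
      _ = (2 : ℝ) ^ k * ((2 : ℝ) ^ (r + k) * (2 : ℝ) ^ (r + k)) := by rw [← mul_sum, gf_sum_sum_W_sq]
  have hK : Real.sqrt ((2 : ℝ) ^ (r + k)) ^ 2 = (2 : ℝ) ^ (r + k) := Real.sq_sqrt (by positivity)
  rw [le_div_iff₀ (by positivity : (0 : ℝ) < (2 : ℝ) ^ r)]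
  have e : ((2 : ℝ) ^ (r + k) * Real.sqrt ((2 : ℝ) ^ (r + k)) * forrelation f g) ^ 2 =
      ((2 : ℝ) ^ k * ((2 : ℝ) ^ (r + k) * (2 : ℝ) ^ (r + k))) * (forrelation f g ^ 2 * (2 : ℝ) ^ r) := by
    rw [mul_pow, mul_pow, hK, pow_add]; ring
  rw [e, mul_comm (((univ.image lam).card : ℝ))] at hmain
  exact le_of_mul_le_mul_left hmain (by positivity)

/-- **More linear than nonlinear variables kills near-exactness**: `Φ(f,g)² ≤ 2^k / 2^r` for every partner `f`
(`|λ(𝔽₂^k)| ≤ 2^k`); in particular `r > k ⇒ Φ(f,g)² ≤ 1/2`. [folklore] -/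
theorem gf_forrelation_sq_le_two_pow (f g : (Fin (r + k) → Bool) → Bool)
    (lam : (Fin k → Bool) → (Fin r → Bool)) (h : (Fin k → Bool) → Bool)
    (hg : ∀ (u : Fin r → Bool) (y : Fin k → Bool), signOf (g (Fin.append u y)) = twist u (lam y) * signOf (h y)) :
    forrelation f g ^ 2 ≤ (2 : ℝ) ^ k / (2 : ℝ) ^ r := by
  refine (gf_forrelation_sq_le_card_image f g lam h hg).trans (div_le_div_of_nonneg_right ?_ (by positivity))
  have hc : (univ.image lam).card ≤ 2 ^ k := by
    refine card_image_le.trans ?_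
    rw [card_univ, Fintype.card_fun, Fintype.card_bool, Fintype.card_fin]
  exact_mod_cast hc

/-- `r > k ⇒ Φ(f,g)² ≤ 1/2` for every partner of a fibration with more linear than nonlinear variables. [folklore] -/
theorem gf_forrelation_sq_le_half (hrk : k < r) (f g : (Fin (r + k) → Bool) → Bool)
    (lam : (Fin k → Bool) → (Fin r → Bool)) (h : (Fin k → Bool) → Bool)
    (hg : ∀ (u : Fin r → Bool) (y : Fin k → Bool), signOf (g (Fin.append u y)) = twist u (lam y) * signOf (h y)) :
    forrelation f g ^ 2 ≤ 1 / 2 := by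
  refine (gf_forrelation_sq_le_two_pow f g lam h hg).trans ?_
  rw [div_le_div_iff₀ (by positivity) (by norm_num), one_mul, ← pow_succ]
  exact pow_le_pow_right₀ (by norm_num) (by omega)

/-- **Fibre-size bound.**  For EVERY Boolean `f` on `r + k` bits: `Φ(f,g) ≤ Σ_a √(|λ⁻¹(a)| / 2^{r+k})` — each block
`a` contributes at most `2^r · 2^k · √|λ⁻¹(a)|` to the forrelation sum (Cauchy–Schwarz on the fibre against Parseval
for the slice `f(a ‖ ·)`).  Equality structure: `1` needs all fibres singletons (`r = k`, `λ` bijective). [folklore] -/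
theorem gf_forrelation_le_sum_sqrt_card_fibre (f g : (Fin (r + k) → Bool) → Bool)
    (lam : (Fin k → Bool) → (Fin r → Bool)) (h : (Fin k → Bool) → Bool)
    (hg : ∀ (u : Fin r → Bool) (y : Fin k → Bool), signOf (g (Fin.append u y)) = twist u (lam y) * signOf (h y)) :
    forrelation f g ≤ ∑ a : Fin r → Bool,
      Real.sqrt (((univ.filter fun y => lam y = a).card : ℝ) / (2 : ℝ) ^ (r + k)) := by
  -- the forrelation sum, block by block
  have hS : Real.sqrt ((2 : ℝ) ^ (3 * (r + k))) * forrelation f g =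
      (2 : ℝ) ^ r * ∑ a : Fin r → Bool, ∑ y : Fin k → Bool, (if lam y = a then signOf (h y) *
        ∑ b : Fin k → Bool, signOf (f (Fin.append a b)) * twist b y else 0) := by
    have e := gf_fsum_eq f g lam h hg
    unfold forrelation
    rw [← mul_assoc, mul_inv_cancel₀ (by positivity), one_mul, e]
    congr 1
    rw [sum_comm]
    refine sum_congr rfl fun y _ => ?_
    rw [sum_ite_eq]
    simp
  -- per block: Cauchy–Schwarz against Parseval for the slice `f(a ‖ ·)`
  have hblock : ∀ a : Fin r → Bool,
      ∑ y : Fin k → Bool, (if lam y = a then signOf (h y) *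
          ∑ b : Fin k → Bool, signOf (f (Fin.append a b)) * twist b y else 0) ≤
        Real.sqrt (((univ.filter fun y => lam y = a).card : ℝ)) * (2 : ℝ) ^ k := by
    intro a
    have hc := Real.sum_mul_le_sqrt_mul_sqrt (univ : Finset (Fin k → Bool))
      (fun y => if lam y = a then signOf (h y) else 0)
      (fun y => W (fun b => signOf (f (Fin.append a b))) y)
    have e1 : ∑ y : Fin k → Bool, (if lam y = a then signOf (h y) *
          ∑ b : Fin k → Bool, signOf (f (Fin.append a b)) * twist b y else 0) =
        ∑ y : Fin k → Bool, (if lam y = a then signOf (h y) else 0) *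
          W (fun b => signOf (f (Fin.append a b))) y := by
      refine sum_congr rfl fun y _ => ?_
      unfold W
      split_ifs <;> simp
    have e2 : ∑ y : Fin k → Bool, (if lam y = a then signOf (h y) else 0) ^ 2 =
        ((univ.filter fun y => lam y = a).card : ℝ) := ws_sum_indicator_sq h (fun y => lam y = a)
    have e3 : ∑ y : Fin k → Bool, W (fun b => signOf (f (Fin.append a b))) y ^ 2 = (2 : ℝ) ^ k * (2 : ℝ) ^ k :=
      ls_sum_W_sq (fun b => f (Fin.append a b))
    rw [e1]
    refine hc.trans (le_of_eq ?_)
    rw [e2, e3, Real.sqrt_mul_self (by positivity)]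
  have hR : (0 : ℝ) < Real.sqrt ((2 : ℝ) ^ (3 * (r + k))) := by positivity
  have e4 : ∀ a : Fin r → Bool,
      Real.sqrt ((2 : ℝ) ^ (3 * (r + k))) *
          Real.sqrt (((univ.filter fun y => lam y = a).card : ℝ) / (2 : ℝ) ^ (r + k)) =
        (2 : ℝ) ^ r * (Real.sqrt (((univ.filter fun y => lam y = a).card : ℝ)) * (2 : ℝ) ^ k) := by
    intro a
    rw [← Real.sqrt_mul (by positivity),
      show (2 : ℝ) ^ (3 * (r + k)) * ((((univ.filter fun y => lam y = a).card : ℕ) : ℝ) / (2 : ℝ) ^ (r + k)) =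
        ((2 : ℝ) ^ r * (2 : ℝ) ^ k) ^ 2 * (((univ.filter fun y => lam y = a).card : ℕ) : ℝ) by
        field_simp
        ring,
      Real.sqrt_mul (by positivity), Real.sqrt_sq (by positivity)]
    ring
  have key : Real.sqrt ((2 : ℝ) ^ (3 * (r + k))) * forrelation f g ≤
      Real.sqrt ((2 : ℝ) ^ (3 * (r + k))) * ∑ a : Fin r → Bool,
        Real.sqrt (((univ.filter fun y => lam y = a).card : ℝ) / (2 : ℝ) ^ (r + k)) := by
    rw [hS, mul_sum (a := (2 : ℝ) ^ r), mul_sum (a := Real.sqrt ((2 : ℝ) ^ (3 * (r + k))))]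
    refine sum_le_sum fun a _ => ?_
    rw [e4 a]
    exact mul_le_mul_of_nonneg_left (hblock a) (by positivity)
  exact le_of_mul_le_mul_left key hR

end Fibration

end Summit.QuantumAdvantage.QuantumAdvantage.Theorems.NearExactIsExact.Negative.WalshSupport
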